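import Literature.Computability.MetaComplexity.DPReconstructionGL
import Literature.Computability.Complexity.HeavyStringsEnumeration
import Literature.Computability.Cryptography.GoldreichLevinProgram
import HarnessLib

/-!
# Complexity meta: Hirahara's Thm. 3.12 (reconstruction for `DP_k`) in enumeration form, under `PromiseBPP' ⊆ PromiseP`

Topic `Literature/Computability/MetaComplexity`, sequel of `DPReconstructionGL.lean` (one run of the
randomised reconstruction and its success probability) and consumer of
`Complexity/HeavyStringsEnumeration.lean` (enumerating heavy outputs under `pr-BPP = pr-P`), for
S. Hirahara, *Average-case hardness of NP from exponential worst-case hardness assumptions*, STOC 2021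
(ECCC TR21-058, numbering cited). Main result:

* `Hirahara2021_dpEnum_of_PromiseBPP'_subset` — **if `PromiseBPP' ⊆ PromiseP` then for every `D₀ ∈ P` there
  is `E ∈ FP` such that, whenever the test `w ↦ [⟨a, w⟩ ∈ D₀]` `1/e`-distinguishes `DP_k(x; ·)` from
  uniform, the list coded by `E ⟨a, 1^{|x|}, 1^{2^k}, 1ᵉ⟩` contains `x`.** This is the remark printed after
  Thm. 3.12 ("in time `poly(ns2^k/δ)`, given a description of the circuit `D`, one can enumerate a list of
  strings that contains `x`") for uniform polynomial-time tests with auxiliary input, with the paper's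
  derandomisation by the generator of Lemma 3.4 replaced by its decision consequence `pr-BPP = pr-P`
  (p. 27) — i.e. exactly the hypothesis `h312` of `UniversalMachine.hasSearchUHS_of_ingredients`
  (`UPSearchAssembly.lean`, the formalised proof of Thm. 8.9) in the form consumed by
  `Hirahara2021_hasUHS_of_mem_UP_of_BFP` and `Cryptography.hirahara_UP_DistNP_of_nonempty_of_BFP`, now a
  theorem relative to `PromiseBPP' ⊆ PromiseP` (which `BuhrmanFortnowPavan2004_PromiseBPP'_subset_PromiseP`
  supplies under `DistNP ⊆ AvgP`).

Contents: the parameters (`Mkk = 2ne²4^k + 1`, `kk = ⌊log₂ Mkk⌋ + 1` seeds so that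
`n ≤ 2(δ/2^{k+1})²(2^kk − 1)` for `δ = 1/e`, `seeds_enough`; `C` coins; `M = 8e·2^k·2Mkk ≥ 8e·2^k·2^kk`
runs), the run as an `FP` program on `⟨params, coins⟩` (`recF`: the context record and the two clocked
loops of `Cryptography/GoldreichLevinProgram.lean` around one call of the test, with the parameters read
off `params` in unary — `recF_apply`, `recF_mem_FP`), the coin and run counts as `FP` functions of `params`
(`coinsF`, `runsF`), and the assembly.

## References

* S. Hirahara, ECCC TR21-058 (2021): Lemma 3.11, Thm. 3.12 and the remark following it, Lemma 3.14
  (pp. 23–25); p. 27 ("`pr-BPP = pr-P` by Lemma 3.4"); proof of Thm. 8.9, Claim 8.11 (pp. 41–42).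
* O. Goldreich, *Foundations of Cryptography I*, CUP 2001, Thm. 2.5.6 (proof, §2.5.3).
* S. Arora, B. Barak, *Computational Complexity: A Modern Approach*, CUP 2009, Thm. 9.12, §1.3–1.4.
* O. Goldreich, *On promise problems: a survey*, LNCS 3895 (2006), §1.2.
-/

noncomputable section

namespace Literature.Computability.MetaComplexity

open _root_.Computability Polynomial Complexity Complexity.Brick Complexity.Plumb Complexity.OracleCompose Complexity.HashBricks
open Literature.Computability.Cryptography Cryptography.CondRed Cryptography.GLDec Cryptography.GLBricks Cryptography.GLInv Cryptography.GLProg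

namespace DPRecon

/-! ### The parameters of the reconstruction, from `params = ⟨a, ⟨1ⁿ, ⟨1^{2^k}, 1ᵉ⟩⟩⟩` -/

/-- `M_kk = 2·n·e²·4^k + 1`: the number of pairwise independent queries wanted (`2^kk ≥ M_kk`). [folklore] -/
def Mkk (n k e : ℕ) : ℕ := 2 * n * e * e * 2 ^ k * 2 ^ k + 1

/-- `kk = ⌊log₂ M_kk⌋ + 1`, the number of Rackoff seeds. [folklore] -/
def kkOf (n k e : ℕ) : ℕ := Nat.log 2 (Mkk n k e) + 1

/-- The number of coins of one run: `1 + k + 1 + kn + k + kk·n + kk`. [folklore] -/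
def coinsOf (n k e : ℕ) : ℕ := 1 + (k + (1 + (k * n + (k + (kkOf n k e * n + kkOf n k e)))))

/-- The number of runs `M = 8·e·2^k·(2 M_kk)` (`≥ 8e·2^k·2^kk`). [folklore] -/
def runsOf (n k e : ℕ) : ℕ := 8 * e * 2 ^ k * (2 * Mkk n k e)

/-- `M_kk < 2^kk`. [folklore] -/
theorem Mkk_lt_two_pow (n k e : ℕ) : Mkk n k e < 2 ^ kkOf n k e := Nat.lt_pow_succ_log_self one_lt_two _

/-- `2^kk ≤ 2 M_kk`. [folklore] -/
theorem two_pow_kkOf_le (n k e : ℕ) : 2 ^ kkOf n k e ≤ 2 * Mkk n k e := by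
  rw [kkOf, pow_succ, mul_comm]
  exact Nat.mul_le_mul_left 2 (Nat.pow_log_le_self 2 (by simp [Mkk]))

/-- **Enough seeds**: `n ≤ 2·(δ/2^k/2)²·(2^kk − 1)` for `δ = 1/e`. [folklore] -/
theorem seeds_enough (n k : ℕ) {e : ℕ} (he : 1 ≤ e) :
    (n : ℝ) ≤ 2 * (1 / (e : ℝ) / 2 ^ k / 2) ^ 2 * (2 ^ kkOf n k e - 1 : ℕ) := by
  have h1 : Mkk n k e ≤ 2 ^ kkOf n k e - 1 := Nat.le_sub_one_of_lt (Mkk_lt_two_pow n k e)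
  have h2 : ((2 * n * e * e * 2 ^ k * 2 ^ k + 1 : ℕ) : ℝ) ≤ ((2 ^ kkOf n k e - 1 : ℕ) : ℝ) := by exact_mod_cast h1
  have he' : (1 : ℝ) ≤ e := by exact_mod_cast he
  push_cast at h2
  have hsq : 2 * (1 / (e : ℝ) / 2 ^ k / 2) ^ 2 = 1 / (2 * e * e * 2 ^ k * 2 ^ k) := by
    field_simp
  rw [hsq, one_div_mul_eq_div, le_div_iff₀ (by positivity)]
  nlinarith [show (0 : ℝ) ≤ n by positivity, show (0 : ℝ) < 2 ^ k by positivity]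

/-! ### The run as a string function on `⟨params, coins⟩` (the `FP` program) -/

section Program

variable (D₀ : Set (List Bool))

/-- `1ⁿ` (from `z = ⟨params, c⟩`). [folklore] -/
noncomputable def uN : List Bool → List Bool := onesFn ∘ nthF 1 ∘ fstF
/-- `1ᵉ`. [folklore] -/
noncomputable def uE : List Bool → List Bool := onesFn ∘ sndPow 2 ∘ fstF
/-- `1^{2^k}` (normalised). [folklore] -/
noncomputable def u2 : List Bool → List Bool := onesFn ∘ nthF 2 ∘ fstF
/-- `1ᵏ = 1^{⌊log₂ 2^k⌋}`. [folklore] -/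
noncomputable def KU : List Bool → List Bool := logU ∘ nthF 2 ∘ fstF
/-- `1^{M_kk}`. [folklore] -/
noncomputable def MkkU : List Bool → List Bool :=
  List.cons true ∘ umulFn ∘ fanoutFn (umulFn ∘ fanoutFn (umulFn ∘ fanoutFn (umulFn ∘ fanoutFn
    (List.cons true ∘ List.cons true ∘ fun _ => []) uN) uE) uE) (umulFn ∘ fanoutFn u2 u2)
/-- `1^{kk}`. [folklore] -/
noncomputable def kkU : List Bool → List Bool := List.cons true ∘ logU ∘ MkkU
/-- The ruler `1^{2 M_kk}` (`≥ 2^kk`). [folklore] -/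
noncomputable def rulerU : List Bool → List Bool := concatFn ∘ fanoutFn MkkU MkkU
/-- `1^{2^kk − 1}`. [folklore] -/
noncomputable def twoKm1 : List Bool → List Bool := binToUnaryFn ∘ fanoutFn rulerU kkU
/-- `1^{kn}`. [folklore] -/
noncomputable def KnU : List Bool → List Bool := umulFn ∘ fanoutFn KU uN
/-- `1^{kk·n}`. [folklore] -/
noncomputable def knU : List Bool → List Bool := umulFn ∘ fanoutFn kkU uN
/-- The side information `y = hdr a = ⟨a, ε⟩`. [folklore] -/
noncomputable def yF : List Bool → List Bool := fanoutFn (fstF ∘ fstF) fun _ => []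

/-- `c ⇂ 1`. [folklore] -/
noncomputable def c1 : List Bool → List Bool := dropFn ∘ fanoutFn (fun _ => ones 1) sndF
/-- `[sgn]`. [folklore] -/
noncomputable def sgnB : List Bool → List Bool := headBitFn ∘ takeFn ∘ fanoutFn (fun _ => ones 1) sndF
/-- `mask_J` (`k` bits). [folklore] -/
noncomputable def maskJF : List Bool → List Bool := CondGen.fitF KU (takeFn ∘ fanoutFn KU c1)
/-- `c ⇂ (1 + k)`. [folklore] -/
noncomputable def c2 : List Bool → List Bool := dropFn ∘ fanoutFn KU c1
/-- `[β]`. [folklore] -/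
noncomputable def βB : List Bool → List Bool := headBitFn ∘ takeFn ∘ fanoutFn (fun _ => ones 1) c2
/-- The next cut. [folklore] -/
noncomputable def c3 : List Bool → List Bool := dropFn ∘ fanoutFn (fun _ => ones 1) c2
/-- `ω'` (`kn` bits). [folklore] -/
noncomputable def ωF : List Bool → List Bool := CondGen.fitF KnU (takeFn ∘ fanoutFn KnU c3)
/-- The next cut. [folklore] -/
noncomputable def c4 : List Bool → List Bool := dropFn ∘ fanoutFn KnU c3
/-- `v` (`k` bits). [folklore] -/
noncomputable def vF : List Bool → List Bool := CondGen.fitF KU (takeFn ∘ fanoutFn KU c4)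
/-- The next cut. [folklore] -/
noncomputable def c5 : List Bool → List Bool := dropFn ∘ fanoutFn KU c4
/-- The seeds (`kk·n` bits). [folklore] -/
noncomputable def SF : List Bool → List Bool := CondGen.fitF knU (takeFn ∘ fanoutFn knU c5)
/-- The next cut. [folklore] -/
noncomputable def c6 : List Bool → List Bool := dropFn ∘ fanoutFn knU c5
/-- `τ` (`kk` bits). [folklore] -/
noncomputable def τF : List Bool → List Bool := CondGen.fitF kkU (takeFn ∘ fanoutFn kkU c6)

/-- `1^{j₀}`, `j₀ = firstTrue mask_J`. [folklore] -/
noncomputable def j0U : List Bool → List Bool := firstTrueFn ∘ maskJF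
/-- The flag `[k ≤ j₀]`. [folklore] -/
noncomputable def flagB : List Bool → List Bool := lenLeFn X ∘ fanoutFn j0U KU
/-- `1^{j₀ n}`. [folklore] -/
noncomputable def j0nU : List Bool → List Bool := umulFn ∘ fanoutFn j0U uN
/-- The prefix `ω' ↾ j₀n`. [folklore] -/
noncomputable def preF : List Bool → List Bool := takeFn ∘ fanoutFn j0nU ωF
/-- Block `j₀` of `ω'`. [folklore] -/
noncomputable def blkF : List Bool → List Bool := takeFn ∘ fanoutFn uN (dropFn ∘ fanoutFn j0nU ωF)
/-- The suffix `ω' ⇂ (j₀+1)n`. [folklore] -/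
noncomputable def postF : List Bool → List Bool := dropFn ∘ fanoutFn (umulFn ∘ fanoutFn (List.cons true ∘ j0U) uN) ωF
/-- The masked xor `M` of the blocks of `ω'`. [folklore] -/
noncomputable def MF : List Bool → List Bool := mxFn ∘ fanoutFn (fanoutFn uN KU) (fanoutFn maskJF ωF)
/-- The parity `[⊕_{j∈J} v_j]`. [folklore] -/
noncomputable def parJV : List Bool → List Bool := andParityFn ∘ fanoutFn maskJF vF

/-- **The context record** `⟨1ⁿ, 1^kk, 1^{2^kk−1}, y, [sgn], [flag], [β], [par], pre, M, blk, post, v, ε, S, τ⟩`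
(the record of `GoldreichLevinProgram.lean`, with no coins for the test). [folklore] -/
noncomputable def ctxF : List Bool → List Bool :=
  fanoutFn uN (fanoutFn kkU (fanoutFn twoKm1 (fanoutFn yF (fanoutFn sgnB (fanoutFn flagB (fanoutFn βB
    (fanoutFn parJV (fanoutFn preF (fanoutFn MF (fanoutFn blkF (fanoutFn postF (fanoutFn vF
      (fanoutFn (fun _ => []) (fanoutFn SF τF))))))))))))))

/-- **The run as a string function on `z = ⟨params, c⟩`**: `n` coordinate rounds of the
Goldreich–Levin decoder of `GoldreichLevinProgram.lean` from `⟨1ⁿ, ⟨CTX, ⟨ε, ε⟩⟩⟩`, then the bits.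
[Hirahara 2021 (ECCC TR21-058), Lemma 3.11; Goldreich 2001, Thm. 2.5.6 (proof, §2.5.3); Arora–Barak 2009, Thm. 9.12]
[cite: Hirahara2021, Lemma 3.11] -/
noncomputable def recF : List Bool → List Bool :=
  sndPow 2 ∘ (fun z => (bitRound (testAlg D₀))^[(X : Polynomial ℕ).eval (boolUnpair z).1.length] z) ∘
    fanoutFn uN (fanoutFn ctxF (fanoutFn (fun _ => []) (fun _ => [])))

/-- The coin count `1^C` as a function of `params`. [folklore] -/
noncomputable def coinsF : List Bool → List Bool :=
  (concatFn ∘ fanoutFn (fun _ => ones 1) (concatFn ∘ fanoutFn KU (concatFn ∘ fanoutFn (fun _ => ones 1)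
    (concatFn ∘ fanoutFn KnU (concatFn ∘ fanoutFn KU (concatFn ∘ fanoutFn knU kkU)))))) ∘ fanoutFn id (fun _ => [])

/-- The run count `1^M`, `M = 8e·2^k·2M_kk`, as a function of `params`. [folklore] -/
noncomputable def runsF : List Bool → List Bool :=
  (umulFn ∘ fanoutFn (umulFn ∘ fanoutFn (umulFn ∘ fanoutFn (fun _ => ones 8) uE) u2) rulerU) ∘ fanoutFn id (fun _ => [])

end Program

/-! ### Values on genuine parameters -/

section Values

variable (a c : List Bool) (n k e : ℕ)

/-- `⟨dpEnumEnc a n k e, c⟩`, the argument of the run. [folklore] -/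
def zOf : List Bool := boolPair (dpEnumEnc a n k e) c

/-- Value of `uN`. [folklore] -/
theorem uN_apply : uN (zOf a c n k e) = ones n := by
  simp [uN, zOf, dpEnumEnc, onesFn, Complexity.unaryEncodeNat_eq_replicate, ones]
/-- Value of `uE`. [folklore] -/
theorem uE_apply : uE (zOf a c n k e) = ones e := by
  simp [uE, zOf, dpEnumEnc, onesFn, Complexity.unaryEncodeNat_eq_replicate, ones, sndPow]
/-- Value of `u2`. [folklore] -/
theorem u2_apply : u2 (zOf a c n k e) = ones (2 ^ k) := by
  simp [u2, zOf, dpEnumEnc, onesFn, Complexity.unaryEncodeNat_eq_replicate, ones, nthF]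
/-- Value of `KU`. [folklore] -/
theorem KU_apply : KU (zOf a c n k e) = ones k := by
  simp [KU, zOf, dpEnumEnc, nthF, Complexity.unaryEncodeNat_eq_replicate, Nat.log_pow one_lt_two]
/-- Value of `MkkU`. [folklore] -/
theorem MkkU_apply : MkkU (zOf a c n k e) = ones (Mkk n k e) := by
  simp only [MkkU, Function.comp_apply, fanoutFn_apply, uN_apply, uE_apply, u2_apply, umulFn_boolPair, Mkk]
  rw [show ([] : List Bool) = ones 0 from rfl, true_cons_ones, true_cons_ones, umulFn_boolPair, umulFn_boolPair, umulFn_boolPair,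
    umulFn_boolPair, true_cons_ones]
  congr 1; ring
/-- Value of `kkU`. [folklore] -/
theorem kkU_apply : kkU (zOf a c n k e) = ones (kkOf n k e) := by
  simp only [kkU, Function.comp_apply, MkkU_apply, logU_apply, List.length_replicate, true_cons_ones, kkOf]
/-- Value of `rulerU`. [folklore] -/
theorem rulerU_apply : rulerU (zOf a c n k e) = ones (2 * Mkk n k e) := by
  simp only [rulerU, Function.comp_apply, fanoutFn_apply, MkkU_apply, concatFn_boolPair, Com.ones_append]; congr 1; ring
/-- Value of `twoKm1`. [folklore] -/
theorem twoKm1_apply : twoKm1 (zOf a c n k e) = ones (2 ^ kkOf n k e - 1) := by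
  simp only [twoKm1, Function.comp_apply, fanoutFn_apply, rulerU_apply, kkU_apply, binToUnaryFn_boolPair, GLProg.bitsToNat_ones,
    List.length_replicate]
  rw [min_eq_left]
  have := two_pow_kkOf_le n k e
  omega
/-- Value of `KnU`. [folklore] -/
theorem KnU_apply : KnU (zOf a c n k e) = ones (k * n) := by
  simp only [KnU, Function.comp_apply, fanoutFn_apply, KU_apply, uN_apply, umulFn_boolPair]
/-- Value of `knU`. [folklore] -/
theorem knU_apply : knU (zOf a c n k e) = ones (kkOf n k e * n) := by
  simp only [knU, Function.comp_apply, fanoutFn_apply, kkU_apply, uN_apply, umulFn_boolPair]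
/-- Value of `yF`. [folklore] -/
theorem yF_apply : yF (zOf a c n k e) = hdr a := by
  rw [show hdr a = boolPair a [] by simp [hdr, boolPair]]
  simp [yF, zOf, dpEnumEnc]

/-- The segments of the coins (the `let`s of `run`). [folklore] -/
def mc1 : List Bool := c.drop 1
/-- Segment. [folklore] -/
def mc2 : List Bool := (mc1 c).drop k
/-- Segment. [folklore] -/
def mc3 : List Bool := (mc2 c k).drop 1
/-- Segment. [folklore] -/
def mc4 : List Bool := (mc3 c k).drop (k * n)
/-- Segment. [folklore] -/
def mc5 : List Bool := (mc4 c n k).drop k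
/-- Segment. [folklore] -/
def mc6 : List Bool := (mc5 c n k).drop (kkOf n k e * n)
/-- `mask_J`. [folklore] -/
def mMask : List Bool := CondParams.fitLen ((mc1 c).take k) k
/-- `ω'`. [folklore] -/
def mω : List Bool := CondParams.fitLen ((mc3 c k).take (k * n)) (k * n)
/-- `v`. [folklore] -/
def mv : List Bool := CondParams.fitLen ((mc4 c n k).take k) k
/-- The seeds. [folklore] -/
def mS : List Bool := CondParams.fitLen ((mc5 c n k).take (kkOf n k e * n)) (kkOf n k e * n)
/-- `τ`. [folklore] -/
def mτ : List Bool := CondParams.fitLen ((mc6 c n k e).take (kkOf n k e)) (kkOf n k e)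

/-- **The run through the named segments.** [folklore] -/
theorem run_eq (D₀ : Set (List Bool)) :
    run D₀ a n k (kkOf n k e) c = candStr n (kkOf n k e)
      (predStr (testAlg D₀) n k ((c.take 1).headD false) (mMask c k) (((mc2 c k).take 1).headD false) (mω c n k) (mv c n k) [] (hdr a))
      (mS c n k e) (mτ c n k e) := by
  simp only [run, mMask, mc1, mc2, mω, mc3, mc4, mv, mc5, mS, mc6, mτ]

/-- Value of `c1`. [folklore] -/
theorem c1_apply : c1 (zOf a c n k e) = mc1 c := by
  simp only [c1, zOf, Function.comp_apply, fanoutFn_apply, sndF_boolPair, dropFn_boolPair, List.length_replicate, mc1]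
/-- Value of `sgnB`. [folklore] -/
theorem sgnB_apply : sgnB (zOf a c n k e) = [(c.take 1).headD false] := by
  simp only [sgnB, zOf, Function.comp_apply, fanoutFn_apply, sndF_boolPair, takeFn_boolPair, List.length_replicate, headBitFn_apply]
/-- Value of `maskJF`. [folklore] -/
theorem maskJF_apply : maskJF (zOf a c n k e) = mMask c k := by
  simp only [maskJF, Function.comp_apply, fanoutFn_apply, CondGen.fitF_apply, KU_apply, c1_apply, takeFn_boolPair, List.length_replicate, mMask]
/-- Value of `c2`. [folklore] -/
theorem c2_apply : c2 (zOf a c n k e) = mc2 c k := by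
  simp only [c2, Function.comp_apply, fanoutFn_apply, KU_apply, c1_apply, dropFn_boolPair, List.length_replicate, mc2]
/-- Value of `βB`. [folklore] -/
theorem βB_apply : βB (zOf a c n k e) = [((mc2 c k).take 1).headD false] := by
  simp only [βB, Function.comp_apply, fanoutFn_apply, c2_apply, takeFn_boolPair, List.length_replicate, headBitFn_apply]
/-- Value of `c3`. [folklore] -/
theorem c3_apply : c3 (zOf a c n k e) = mc3 c k := by
  simp only [c3, Function.comp_apply, fanoutFn_apply, c2_apply, dropFn_boolPair, List.length_replicate, mc3]
/-- Value of `ωF`. [folklore] -/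
theorem ωF_apply : ωF (zOf a c n k e) = mω c n k := by
  simp only [ωF, Function.comp_apply, fanoutFn_apply, CondGen.fitF_apply, KnU_apply, c3_apply, takeFn_boolPair, List.length_replicate, mω]
/-- Value of `c4`. [folklore] -/
theorem c4_apply : c4 (zOf a c n k e) = mc4 c n k := by
  simp only [c4, Function.comp_apply, fanoutFn_apply, KnU_apply, c3_apply, dropFn_boolPair, List.length_replicate, mc4]
/-- Value of `vF`. [folklore] -/
theorem vF_apply : vF (zOf a c n k e) = mv c n k := by
  simp only [vF, Function.comp_apply, fanoutFn_apply, CondGen.fitF_apply, KU_apply, c4_apply, takeFn_boolPair, List.length_replicate, mv]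
/-- Value of `c5`. [folklore] -/
theorem c5_apply : c5 (zOf a c n k e) = mc5 c n k := by
  simp only [c5, Function.comp_apply, fanoutFn_apply, KU_apply, c4_apply, dropFn_boolPair, List.length_replicate, mc5]
/-- Value of `SF`. [folklore] -/
theorem SF_apply : SF (zOf a c n k e) = mS c n k e := by
  simp only [SF, Function.comp_apply, fanoutFn_apply, CondGen.fitF_apply, knU_apply, c5_apply, takeFn_boolPair, List.length_replicate, mS]
/-- Value of `c6`. [folklore] -/
theorem c6_apply : c6 (zOf a c n k e) = mc6 c n k e := by
  simp only [c6, Function.comp_apply, fanoutFn_apply, knU_apply, c5_apply, dropFn_boolPair, List.length_replicate, mc6]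
/-- Value of `τF`. [folklore] -/
theorem τF_apply : τF (zOf a c n k e) = mτ c n k e := by
  simp only [τF, Function.comp_apply, fanoutFn_apply, CondGen.fitF_apply, kkU_apply, c6_apply, takeFn_boolPair, List.length_replicate, mτ]
/-- Value of `j0U`. [folklore] -/
theorem j0U_apply : j0U (zOf a c n k e) = ones (firstTrue (mMask c k)) := by
  simp only [j0U, Function.comp_apply, maskJF_apply, firstTrueFn_apply]
/-- Value of `flagB`. [folklore] -/
theorem flagB_apply : flagB (zOf a c n k e) = [decide (k ≤ firstTrue (mMask c k))] := by
  simp only [flagB, Function.comp_apply, fanoutFn_apply, j0U_apply, KU_apply, lenLeFn_boolPair, List.length_replicate, eval_X]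
/-- Value of `j0nU`. [folklore] -/
theorem j0nU_apply : j0nU (zOf a c n k e) = ones (firstTrue (mMask c k) * n) := by
  simp only [j0nU, Function.comp_apply, fanoutFn_apply, j0U_apply, uN_apply, umulFn_boolPair]
/-- Value of `preF`. [folklore] -/
theorem preF_apply : preF (zOf a c n k e) = (mω c n k).take (firstTrue (mMask c k) * n) := by
  simp only [preF, Function.comp_apply, fanoutFn_apply, j0nU_apply, ωF_apply, takeFn_boolPair, List.length_replicate]
/-- Value of `blkF`. [folklore] -/
theorem blkF_apply : blkF (zOf a c n k e) = ((mω c n k).drop (firstTrue (mMask c k) * n)).take n := by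
  simp only [blkF, Function.comp_apply, fanoutFn_apply, j0nU_apply, ωF_apply, uN_apply, takeFn_boolPair, dropFn_boolPair, List.length_replicate]
/-- Value of `postF`. [folklore] -/
theorem postF_apply : postF (zOf a c n k e) = (mω c n k).drop ((firstTrue (mMask c k) + 1) * n) := by
  simp only [postF, Function.comp_apply, fanoutFn_apply, j0U_apply, ωF_apply, uN_apply, true_cons_ones, umulFn_boolPair,
    dropFn_boolPair, List.length_replicate]
/-- Value of `MF`. [folklore] -/
theorem MF_apply : MF (zOf a c n k e) = maskedXor n k (mMask c k) (mω c n k) := by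
  simp only [MF, Function.comp_apply, fanoutFn_apply, uN_apply, KU_apply, maskJF_apply, ωF_apply, mxFn_boolPair]
/-- Value of `parJV`. [folklore] -/
theorem parJV_apply : parJV (zOf a c n k e) = [ipBit (mMask c k) (mv c n k)] := by
  simp only [parJV, Function.comp_apply, fanoutFn_apply, maskJF_apply, vF_apply, andParityFn_boolPair, ipBit_eq_decide_odd]

/-- **The context record on genuine parameters.** [folklore] -/
theorem ctxF_apply : ctxF (zOf a c n k e) =
    GLProg.ctxRec n (kkOf n k e) (2 ^ kkOf n k e - 1) (hdr a) ((c.take 1).headD false) (decide (k ≤ firstTrue (mMask c k)))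
      (((mc2 c k).take 1).headD false) (ipBit (mMask c k) (mv c n k))
      ((mω c n k).take (firstTrue (mMask c k) * n)) (maskedXor n k (mMask c k) (mω c n k))
      (((mω c n k).drop (firstTrue (mMask c k) * n)).take n) ((mω c n k).drop ((firstTrue (mMask c k) + 1) * n))
      (mv c n k) [] (mS c n k e) (mτ c n k e) := by
  simp only [ctxF, fanoutFn_apply, uN_apply, kkU_apply, twoKm1_apply, yF_apply, sgnB_apply, flagB_apply, βB_apply, parJV_apply,
    preF_apply, MF_apply, blkF_apply, postF_apply, vF_apply, SF_apply, τF_apply, GLProg.ctxRec]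

/-- **`recF ⟨dpEnumEnc a n k e, c⟩ = run D₀ a n k kk c`.** [cite: Hirahara2021, Lemma 3.11] -/
theorem recF_apply (D₀ : Set (List Bool)) : recF D₀ (zOf a c n k e) = run D₀ a n k (kkOf n k e) c := by
  have hinit : fanoutFn uN (fanoutFn ctxF (fanoutFn (fun _ => []) (fun _ => []))) (zOf a c n k e) =
      boolPair (ones n) (boolPair (ctxF (zOf a c n k e)) (boolPair (ones 0) [])) := by
    simp only [fanoutFn_apply, uN_apply]; rfl
  rw [run_eq, recF, Function.comp_apply, Function.comp_apply, hinit, boolUnpair_boolPair, List.length_replicate, eval_X,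
    ctxF_apply, GLProg.iterate_bitRound, zero_add, List.nil_append, sndPow_succ_boolPair, sndPow_succ_boolPair, sndPow_zero_boolPair,
    candStr, List.ofFn_eq_map]
  rw [show List.range' 0 n = List.range n from List.range_eq_range'.symm, ← List.map_coe_finRange_eq_range, List.map_map]
  refine List.map_congr_left fun i _ => ?_
  simp only [Function.comp_apply, GLProg.bitRec, GLProg.cntRec, candBit, voteCount, vote, GLProg.voteRec, GLProg.predRec_eq]
  rw [decide_eq_decide]
  have := Nat.one_le_two_pow (n := kkOf n k e)
  omega

/-- Value of `coinsF`. [folklore] -/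
theorem coinsF_apply : coinsF (dpEnumEnc a n k e) = ones (coinsOf n k e) := by
  have h : fanoutFn id (fun _ => []) (dpEnumEnc a n k e) = zOf a [] n k e := by rw [fanoutFn_apply]; rfl
  simp only [coinsF, Function.comp_apply, h, fanoutFn_apply, KU_apply, KnU_apply, knU_apply, kkU_apply, concatFn_boolPair,
    Com.ones_append, coinsOf]

/-- Value of `runsF`. [folklore] -/
theorem runsF_apply : runsF (dpEnumEnc a n k e) = ones (runsOf n k e) := by
  have h : fanoutFn id (fun _ => []) (dpEnumEnc a n k e) = zOf a [] n k e := by rw [fanoutFn_apply]; rfl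
  simp only [runsF, Function.comp_apply, h, fanoutFn_apply, uE_apply, u2_apply, rulerU_apply, umulFn_boolPair, runsOf]

/-- `|nthF 1 (dpEnumEnc a n k e)| = n`. [folklore] -/
theorem length_nthF_one_dpEnumEnc : (nthF 1 (dpEnumEnc a n k e)).length = n := by
  simp [dpEnumEnc, nthF, Complexity.unaryEncodeNat_eq_replicate]

end Values

/-! ### Polynomial time -/

section FPProofs

variable (D₀ : Set (List Bool))

/-- The dressed test as a string function is in `FP` for `D₀ ∈ P`. [folklore] -/
theorem dStr_testAlg_mem_FP (hD : D₀ ∈ Classes.P) : dStr (testAlg D₀) ∈ FP := by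
  have h : dStr (testAlg D₀) = (fun v => encodeBool (D₀.boolIndicator v)) ∘ sndF ∘ fstF := by
    funext z; simp [dStr, testAlg, sndF, fstF]
  rw [h]
  exact comp_mem_FP (indicatorFn_mem_FP hD) (comp_mem_FP sndF_mem_FP fstF_mem_FP)

/-- The parameter functions are in `FP`. [folklore] -/
theorem params_mem_FP : uN ∈ FP ∧ uE ∈ FP ∧ u2 ∈ FP ∧ KU ∈ FP ∧ MkkU ∈ FP ∧ kkU ∈ FP ∧ rulerU ∈ FP ∧ twoKm1 ∈ FP ∧ KnU ∈ FP ∧ knU ∈ FP := by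
  have huN : uN ∈ FP := comp_mem_FP onesFn_mem_FP (comp_mem_FP (nthF_mem_FP 1) fstF_mem_FP)
  have huE : uE ∈ FP := comp_mem_FP onesFn_mem_FP (comp_mem_FP (sndPow_mem_FP 2) fstF_mem_FP)
  have hu2 : u2 ∈ FP := comp_mem_FP onesFn_mem_FP (comp_mem_FP (nthF_mem_FP 2) fstF_mem_FP)
  have hK : KU ∈ FP := comp_mem_FP logU_mem_FP (comp_mem_FP (nthF_mem_FP 2) fstF_mem_FP)
  have hMkk : MkkU ∈ FP := comp_mem_FP (cons_mem_FP true) (comp_mem_FP umulFn_mem_FP (fanoutFn_mem_FP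
    (comp_mem_FP umulFn_mem_FP (fanoutFn_mem_FP (comp_mem_FP umulFn_mem_FP (fanoutFn_mem_FP (comp_mem_FP umulFn_mem_FP
      (fanoutFn_mem_FP (comp_mem_FP (cons_mem_FP true) (comp_mem_FP (cons_mem_FP true) (const_mem_FP _))) huN)) huE)) huE))
    (comp_mem_FP umulFn_mem_FP (fanoutFn_mem_FP hu2 hu2))))
  have hkk : kkU ∈ FP := comp_mem_FP (cons_mem_FP true) (comp_mem_FP logU_mem_FP hMkk)
  have hruler : rulerU ∈ FP := comp_mem_FP concatFn_mem_FP (fanoutFn_mem_FP hMkk hMkk)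
  have htwo : twoKm1 ∈ FP := comp_mem_FP binToUnaryFn_mem_FP (fanoutFn_mem_FP hruler hkk)
  have hKn : KnU ∈ FP := comp_mem_FP umulFn_mem_FP (fanoutFn_mem_FP hK huN)
  have hkn : knU ∈ FP := comp_mem_FP umulFn_mem_FP (fanoutFn_mem_FP hkk huN)
  exact ⟨huN, huE, hu2, hK, hMkk, hkk, hruler, htwo, hKn, hkn⟩

/-- **`recF D₀ ∈ FP`** for `D₀ ∈ P`. [cite: Hirahara2021, Lemma 3.11] -/
theorem recF_mem_FP (hD : D₀ ∈ Classes.P) : recF D₀ ∈ FP := by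
  obtain ⟨huN, -, -, hK, -, hkk, -, htwo, hKn, hkn⟩ := params_mem_FP
  have hy : yF ∈ FP := fanoutFn_mem_FP (comp_mem_FP fstF_mem_FP fstF_mem_FP) (const_mem_FP _)
  have h1 : c1 ∈ FP := comp_mem_FP dropFn_mem_FP (fanoutFn_mem_FP (const_mem_FP _) sndF_mem_FP)
  have hsgn : sgnB ∈ FP := comp_mem_FP headBitFn_mem_FP (comp_mem_FP takeFn_mem_FP (fanoutFn_mem_FP (const_mem_FP _) sndF_mem_FP))
  have hmask : maskJF ∈ FP := CondGen.fitF_mem_FP hK (comp_mem_FP takeFn_mem_FP (fanoutFn_mem_FP hK h1))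
  have h2 : c2 ∈ FP := comp_mem_FP dropFn_mem_FP (fanoutFn_mem_FP hK h1)
  have hβ : βB ∈ FP := comp_mem_FP headBitFn_mem_FP (comp_mem_FP takeFn_mem_FP (fanoutFn_mem_FP (const_mem_FP _) h2))
  have h3 : c3 ∈ FP := comp_mem_FP dropFn_mem_FP (fanoutFn_mem_FP (const_mem_FP _) h2)
  have hω : ωF ∈ FP := CondGen.fitF_mem_FP hKn (comp_mem_FP takeFn_mem_FP (fanoutFn_mem_FP hKn h3))
  have h4 : c4 ∈ FP := comp_mem_FP dropFn_mem_FP (fanoutFn_mem_FP hKn h3)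
  have hv : vF ∈ FP := CondGen.fitF_mem_FP hK (comp_mem_FP takeFn_mem_FP (fanoutFn_mem_FP hK h4))
  have h5 : c5 ∈ FP := comp_mem_FP dropFn_mem_FP (fanoutFn_mem_FP hK h4)
  have hS : SF ∈ FP := CondGen.fitF_mem_FP hkn (comp_mem_FP takeFn_mem_FP (fanoutFn_mem_FP hkn h5))
  have h6 : c6 ∈ FP := comp_mem_FP dropFn_mem_FP (fanoutFn_mem_FP hkn h5)
  have hτ : τF ∈ FP := CondGen.fitF_mem_FP hkk (comp_mem_FP takeFn_mem_FP (fanoutFn_mem_FP hkk h6))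
  have hj0 : j0U ∈ FP := comp_mem_FP firstTrueFn_mem_FP hmask
  have hflag : flagB ∈ FP := comp_mem_FP (lenLeFn_mem_FP X) (fanoutFn_mem_FP hj0 hK)
  have hj0n : j0nU ∈ FP := comp_mem_FP umulFn_mem_FP (fanoutFn_mem_FP hj0 huN)
  have hpre : preF ∈ FP := comp_mem_FP takeFn_mem_FP (fanoutFn_mem_FP hj0n hω)
  have hblk : blkF ∈ FP := comp_mem_FP takeFn_mem_FP (fanoutFn_mem_FP huN (comp_mem_FP dropFn_mem_FP (fanoutFn_mem_FP hj0n hω)))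
  have hpost : postF ∈ FP := comp_mem_FP dropFn_mem_FP (fanoutFn_mem_FP (comp_mem_FP umulFn_mem_FP (fanoutFn_mem_FP
    (comp_mem_FP (cons_mem_FP true) hj0) huN)) hω)
  have hM : MF ∈ FP := comp_mem_FP mxFn_mem_FP (fanoutFn_mem_FP (fanoutFn_mem_FP huN hK) (fanoutFn_mem_FP hmask hω))
  have hpar : parJV ∈ FP := comp_mem_FP andParityFn_mem_FP (fanoutFn_mem_FP hmask hv)
  have hctx : ctxF ∈ FP :=
    fanoutFn_mem_FP huN (fanoutFn_mem_FP hkk (fanoutFn_mem_FP htwo (fanoutFn_mem_FP hy (fanoutFn_mem_FP hsgn (fanoutFn_mem_FP hflag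
      (fanoutFn_mem_FP hβ (fanoutFn_mem_FP hpar (fanoutFn_mem_FP hpre (fanoutFn_mem_FP hM (fanoutFn_mem_FP hblk (fanoutFn_mem_FP hpost
        (fanoutFn_mem_FP hv (fanoutFn_mem_FP (const_mem_FP _) (fanoutFn_mem_FP hS hτ))))))))))))))
  exact comp_mem_FP (sndPow_mem_FP 2) (comp_mem_FP (iterate_mem_FP (GLProg.bitRound_mem_FP (dStr_testAlg_mem_FP D₀ hD)) 9
    GLProg.length_bitRound_le X) (fanoutFn_mem_FP huN (fanoutFn_mem_FP hctx (fanoutFn_mem_FP (const_mem_FP _) (const_mem_FP _)))))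

/-- `coinsF ∈ FP`. [folklore] -/
theorem coinsF_mem_FP : coinsF ∈ FP := by
  obtain ⟨-, -, -, hK, -, hkk, -, -, hKn, hkn⟩ := params_mem_FP
  have h6 : concatFn ∘ fanoutFn knU kkU ∈ FP := comp_mem_FP concatFn_mem_FP (fanoutFn_mem_FP hkn hkk)
  have h5 : concatFn ∘ fanoutFn KU (concatFn ∘ fanoutFn knU kkU) ∈ FP := comp_mem_FP concatFn_mem_FP (fanoutFn_mem_FP hK h6)
  have h4 : concatFn ∘ fanoutFn KnU (concatFn ∘ fanoutFn KU (concatFn ∘ fanoutFn knU kkU)) ∈ FP :=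
    comp_mem_FP concatFn_mem_FP (fanoutFn_mem_FP hKn h5)
  have h3 : concatFn ∘ fanoutFn (fun _ => ones 1) (concatFn ∘ fanoutFn KnU (concatFn ∘ fanoutFn KU (concatFn ∘ fanoutFn knU kkU))) ∈ FP :=
    comp_mem_FP concatFn_mem_FP (fanoutFn_mem_FP (const_mem_FP _) h4)
  have h2 : concatFn ∘ fanoutFn KU (concatFn ∘ fanoutFn (fun _ => ones 1) (concatFn ∘ fanoutFn KnU (concatFn ∘ fanoutFn KU
      (concatFn ∘ fanoutFn knU kkU)))) ∈ FP := comp_mem_FP concatFn_mem_FP (fanoutFn_mem_FP hK h3)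
  have h1 : concatFn ∘ fanoutFn (fun _ => ones 1) (concatFn ∘ fanoutFn KU (concatFn ∘ fanoutFn (fun _ => ones 1)
      (concatFn ∘ fanoutFn KnU (concatFn ∘ fanoutFn KU (concatFn ∘ fanoutFn knU kkU))))) ∈ FP :=
    comp_mem_FP concatFn_mem_FP (fanoutFn_mem_FP (const_mem_FP _) h2)
  exact comp_mem_FP h1 (fanoutFn_mem_FP (PolyTimeComputable.id _) (const_mem_FP _))

/-- `runsF ∈ FP`. [folklore] -/
theorem runsF_mem_FP : runsF ∈ FP := by
  obtain ⟨-, huE, hu2, -, -, -, hruler, -, -, -⟩ := params_mem_FP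
  have h3 : umulFn ∘ fanoutFn (fun _ => ones 8) uE ∈ FP := comp_mem_FP umulFn_mem_FP (fanoutFn_mem_FP (const_mem_FP _) huE)
  have h2 : umulFn ∘ fanoutFn (umulFn ∘ fanoutFn (fun _ => ones 8) uE) u2 ∈ FP := comp_mem_FP umulFn_mem_FP (fanoutFn_mem_FP h3 hu2)
  have h1 : umulFn ∘ fanoutFn (umulFn ∘ fanoutFn (umulFn ∘ fanoutFn (fun _ => ones 8) uE) u2) rulerU ∈ FP :=
    comp_mem_FP umulFn_mem_FP (fanoutFn_mem_FP h2 hruler)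
  exact comp_mem_FP h1 (fanoutFn_mem_FP (PolyTimeComputable.id _) (const_mem_FP _))

end FPProofs

end DPRecon

/-! ### Thm. 3.12 in enumeration form, under `PromiseBPP' ⊆ PromiseP` -/

open DPRecon in
/-- **Hirahara 2021, Thm. 3.12 (reconstruction for `DP_k`) in enumeration form, for polynomial-time
tests with auxiliary input, under `PromiseBPP' ⊆ PromiseP`.** If `PromiseBPP' ⊆ PromiseP` then for every
`D₀ ∈ P` there is `E ∈ FP` such that for all `a, x, k, e` (`e ≥ 1`): if the test `w ↦ [⟨a, w⟩ ∈ D₀]`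
`1/e`-distinguishes `DP_k(x; ·)` from uniform, then the list coded by `E ⟨a, 1^{|x|}, 1^{2^k}, 1ᵉ⟩`
contains `x` — the remark printed after Thm. 3.12 ("in time `poly(ns2^k/δ)`, given a description of
the circuit `D`, one can enumerate a list of strings that contains `x`"), with the paper's
derandomisation by the pseudorandom generator of Lemma 3.4 replaced by the decision derandomisation
`pr-BPP = pr-P` that the paper derives from it (p. 27) — exactly the hypothesis `h312` of
`UniversalMachine.hasSearchUHS_of_ingredients` / `Hirahara2021_hasUHS_of_mem_UP_of_BFP`. Proof: one run
of the Goldreich–Levin reconstruction (XOR lemma + Rackoff's decoder, `uniformProb_run_eq_ge`) outputs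
`x` with probability `≥ 1/(4e·2^k·2^kk)`, it is polynomial time (`recF_mem_FP`), and the heavy outputs of
a randomised polynomial-time function can be enumerated under `PromiseBPP' ⊆ PromiseP`
(`HeavyEnum.exists_enum_of_PromiseBPP'_subset`).
[Hirahara 2021 (ECCC TR21-058), Thm. 3.12 and the remark following it, Lemma 3.11, Lemma 3.14 (p. 23);
Goldreich–Levin 1989; Goldreich 2001, Thm. 2.5.6; Goldreich 2006, §1.2] [cite: Hirahara2021, Thm. 3.12] -/
theorem Hirahara2021_dpEnum_of_PromiseBPP'_subset (hBPP : PromiseBPP' ⊆ PromiseP) :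
    ∀ D₀ : Language Bool, D₀ ∈ Classes.P → ∃ E : List Bool → List Bool, E ∈ FP ∧
      ∀ (a x : List Bool) (k e : ℕ), 1 ≤ e →
        1 / (e : ℝ) ≤ dpAdvantage k x (fun w => D₀.boolIndicator (boolPair a w)) →
          x ∈ decNil (E (dpEnumEnc a x.length k e)) := by
  intro D₀ hD
  obtain ⟨E, hE, hspec⟩ := HeavyEnum.exists_enum_of_PromiseBPP'_subset hBPP (R := recF D₀) (cF := coinsF) (mF := runsF)
    (nF := nthF 1) (recF_mem_FP D₀ hD) coinsF_mem_FP runsF_mem_FP (nthF_mem_FP 1)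
  refine ⟨E, hE, fun a x k e he hadv => ?_⟩
  obtain ⟨n, hn⟩ : ∃ n, x.length = n := ⟨_, rfl⟩
  rw [hn]
  refine hspec (dpEnumEnc a n k e) x (by rw [length_nthF_one_dpEnumEnc, hn]) ?_
  set xv : List.Vector Bool n := ⟨x, hn⟩ with hxv
  have hx : xv.toList = x := rfl
  rw [coinsF_apply, runsF_apply, List.length_replicate, List.length_replicate]
  -- one run succeeds with probability `≥ 1/(4e 2^k 2^kk)`
  have hrun := uniformProb_run_eq_ge D₀ a n k (kkOf n k e) xv (δ := 1 / (e : ℝ)) (by positivity) (by rw [hx]; exact hadv)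
    (by simp [kkOf]) (seeds_enough n k he) 0
  simp only [Nat.add_zero, hx] at hrun
  have hset : {c : List Bool | run D₀ a n k (kkOf n k e) c = x} = {c | recF D₀ (boolPair (dpEnumEnc a n k e) c) = x} := by
    ext c; rw [Set.mem_setOf_eq, Set.mem_setOf_eq, ← zOf, recF_apply]
  rw [← hset, show coinsOf n k e = 1 + (k + (1 + (k * n + (k + (kkOf n k e * n + kkOf n k e))))) from rfl]
  refine le_trans ?_ (mul_le_mul_of_nonneg_left hrun (by positivity))
  -- `M · 1/(4e 2^k 2^kk) ≥ 2`
  have hM : (8 * (e : ℝ) * 2 ^ k * 2 ^ kkOf n k e) ≤ (runsOf n k e : ℝ) := by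
    have h := two_pow_kkOf_le n k e
    have h' : ((2 ^ kkOf n k e : ℕ) : ℝ) ≤ ((2 * Mkk n k e : ℕ) : ℝ) := by exact_mod_cast h
    simp only [runsOf]; push_cast at h' ⊢
    have : (0 : ℝ) ≤ 8 * e * 2 ^ k := by positivity
    nlinarith
  have he' : (1 : ℝ) ≤ e := by exact_mod_cast he
  have h2 : (2 : ℝ) = (8 * (e : ℝ) * 2 ^ k * 2 ^ kkOf n k e) * (1 / (e : ℝ) / (4 * 2 ^ k * 2 ^ kkOf n k e)) := by
    field_simp; ring
  exact (le_of_eq h2).trans (mul_le_mul_of_nonneg_right hM (by positivity))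

end Literature.Computability.MetaComplexity

end
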